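import Summits.ValiantsHypothesis.Statement
import Literature.Computability.AlgebraicComplexity.CircuitDepth

/-!
# ValiantsHypothesis / Depth4 — assembly

Route `ValiantsHypothesis/Depth4`, item `stmt-ValiantsHypothesis-0329` (assembly): Tavenas'
depth reduction to product-depth `2` for `VP` families (hypothesis, in the tree's unbounded-fan-in
gate-count measure `Literature.CplxAlg.productDepthCircuitSize 2`; Agrawal–Vinay 2008, Koiran 2012,
Tavenas 2015 Thm. 1), `totalDegree per_n = n` (hypothesis), the route thesis
"`per_n` needs product-depth-`2` circuits of size `n^{ω(√n)}`" (`∀ c ∃ n, (n+2)^(c⌊√n⌋+c) < size`),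
the renaming bridge and `per ∈ VNP` imply `VP ℂ ≠ VNP ℂ`. Bookkeeping: were `VP = VNP`, the
permanent would be a `VP` family, Tavenas would bound its product-depth-`2` size by
`(n+2)^(c√n + c)` for one `c` and all `n`, contradicting the thesis at that `c`.
-/

namespace Summit.ValiantsHypothesis.Depth4

/-- Settles stmt-ValiantsHypothesis-0329 (assembly of route Depth4): Tavenas depth reduction ∧
`deg per_n = n` ∧ thesis X_Depth4 ∧ bridge ∧ `per ∈ VNP` ⇒ `ValiantsHypothesis`. [folklore] -/
theorem valiantsHypothesis_of_depth4 :
    (∀ {σ : ℕ → Type} [∀ n, Fintype (σ n)] (f : ∀ n, MvPolynomial (σ n) ℂ),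
        Literature.Computability.AlgebraicComplexity.IsVPFamily f → ∃ c : ℕ, ∀ n : ℕ,
          Literature.Computability.AlgebraicComplexity.productDepthCircuitSize 2 (f n) ≤
            ((n + 2 : ℕ∞) ^ (c * Nat.sqrt ((f n).totalDegree) + c))) →
      (∀ n : ℕ, (Literature.Computability.AlgebraicComplexity.perPoly (Fin n) ℂ).totalDegree = n) →
      (∀ c : ℕ, ∃ n : ℕ, ((n + 2 : ℕ∞) ^ (c * Nat.sqrt n + c)) <
        Literature.Computability.AlgebraicComplexity.productDepthCircuitSize 2 (Literature.Computability.AlgebraicComplexity.perPoly (Fin n) ℂ)) →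
      (Literature.Computability.AlgebraicComplexity.perFamily ℂ ∈ Literature.Computability.AlgebraicComplexity.VP ℂ ↔
        Literature.Computability.AlgebraicComplexity.IsVPFamily (fun n => Literature.Computability.AlgebraicComplexity.perPoly (Fin n) ℂ)) →
      Literature.Computability.AlgebraicComplexity.perFamily_mem_VNP ℂ → ValiantsHypothesis := by
  intro hT hdeg hX hbridge hVNP
  show Literature.Computability.AlgebraicComplexity.VP ℂ ≠ Literature.Computability.AlgebraicComplexity.VNP ℂ
  intro hEq
  have hper : Literature.Computability.AlgebraicComplexity.perFamily ℂ ∈ Literature.Computability.AlgebraicComplexity.VP ℂ := by rw [hEq]; exact hVNP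
  have hVP : Literature.Computability.AlgebraicComplexity.IsVPFamily (fun n => Literature.Computability.AlgebraicComplexity.perPoly (Fin n) ℂ) := hbridge.1 hper
  obtain ⟨c, hc⟩ := hT (fun n => Literature.Computability.AlgebraicComplexity.perPoly (Fin n) ℂ) hVP
  obtain ⟨n, hn⟩ := hX c
  have h := hc n
  simp only [hdeg n] at h
  exact absurd (lt_of_lt_of_le hn h) (lt_irrefl _)

end Summit.ValiantsHypothesis.Depth4
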